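import Summits.AtomisticToContinuum.BoseEinsteinCondensation.Theorems.BECRieszReverseHolderCoarseGrainedReverseHolderVarianceReduction
import Summits.AtomisticToContinuum.BoseEinsteinCondensation.Theorems.BECRieszReverseHolderCoarseGrainedReverseHolderGroundStateEquivalence
import HarnessLib

/-!
# Route `BECRieszReverseHolder`, crux `CoarseGrainedReverseHolder` (stmt-AtomisticToContinuum-12840):
# the last registered stub S3′ is EQUIVALENT to the crux

Supports (does not close) stmt-AtomisticToContinuum-12840 (line `registered`, skeleton
`Cruxes/CoarseGrainedReverseHolder/Lines/registered.lean`, sha `e44ed848…`, lead c5).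

The skeleton of line `registered` is closed modulo exactly one registered stub,
`stub_groundStateShadowVariance` (S3′): for every non-negative ground state `Φ` of `n+1` bosons
in the Dirichlet box of side `L = ((n+1)/ρ)^{1/3}`, the coarse-grained reverse-Hölder functional
obeys `F_{n,ℓ}(Φ) ≤ A · (1 + W_n)`, where `W_n = (L³/n²) · E_b[D_{ℓ²+4η²}]` is the smooth structure
factor of the shadow smeared Riesz-2 gas in the Bose dictionary. This file certifies, kernel-checked,
that this stub carries the WHOLE content of the crux:

* `shadowVariance_of_coarseGrainedReverseHolder` — the crux implies S3′ (crux ⇒ the uniform bound on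
  non-negative ground states, `stub_groundStateBoundOfCrux`; then `A := max C 0` and `1 ≤ 1 + W_n`);
* `coarseGrainedReverseHolder_iff_shadowVariance` — together with the landed
  `coarseGrainedReverseHolder_of_shadowVariance` (S3′ ⇒ crux, using the PROVED engine
  `shadowStructureFactor_bosecorner`: `W_n ≤ C` eventually): `CoarseGrainedReverseHolder ↔ S3′`;
* `shadowVariance_iff_groundStateBound` — S3′ is equivalent to the shadow-free uniform bound on
  non-negative ground states (`coarseGrainedReverseHolder_iff_groundStates`): the factor `(1 + W_n)` is
  decorative once the engine is proved, so the open content of the line is exactly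
  "`F_{n,ℓ}` is bounded on non-negative ground states, uniformly in `n`", with no Riesz-gas object left in it.

Consequence for the planner (lead c5): the registered stub is crux-sized by a kernel certificate; with
`positiveZeroMode_of_coarseGrainedReverseHolder` (Theorems/…Consequences.lean) it implies flat-mode BEC of
non-negative near-minimisers in the thermodynamic limit. Pure composition over landed theorems.
-/

namespace Summit.AtomisticToContinuum.BoseEinsteinCondensation.Theorems.CoarseGrainedReverseHolder

open Literature.MathematicalPhysics.QuantumManyBody
open Literature.MathematicalPhysics.StatisticalMechanics
open Summit.AtomisticToContinuum.BoseEinsteinCondensation.Theses.BECRieszReverseHolder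

/-- **The crux implies the registered stub S3′** (`stub_groundStateShadowVariance` of line `registered`):
if `CoarseGrainedReverseHolder` holds then every non-negative ground state `Φ` obeys
`F_{n,ℓ}(Φ) ≤ A(1 + W_n)` eventually in `n` — indeed `F_{n,ℓ}(Φ) ≤ C` by the crux restricted to ground
states (`stub_groundStateBoundOfCrux`), and `C ≤ max C 0 · (1 + W_n)` in `ℝ≥0∞`. [folklore] -/
theorem shadowVariance_of_coarseGrainedReverseHolder (hC : CoarseGrainedReverseHolder) : ∀ v : ℝ → ENNReal, BoseGas.IsRepulsiveFiniteRange v → ∃ ρ₀ : ℝ, 0 < ρ₀ ∧ ∀ ρ : ℝ, 0 < ρ → ρ < ρ₀ → ∀ ℓ : ℝ, 0 < ℓ → ∃ A : ℝ, ∀ᶠ n : ℕ in Filter.atTop, ∀ (L : ℝ), L = BoseGas.sideLength ρ (n + 1) → ∀ (m : ℕ), m = ⌊L / ℓ⌋₊ → ∀ (a : ℝ), a = (BoseGas.scatteringLength v).toReal → ∀ (b : ℝ), b = 2 * Real.pi ^ (-(3 / 2 : ℝ)) * (a / ρ) ^ (1 / 2 : ℝ) → ∀ (η : ℝ), η = max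 ((8 * Real.pi * ρ * a) ^ (-(1 / 2 : ℝ))) (ρ ^ (-(1 / 3 : ℝ))) → ∀ (H : BoseGas.Config n → ℝ), H = (fun X => ∑ i : Fin n, ∑ j : Fin n with i < j, periodicRieszKernel 2 L η (X i - X j)) → ∀ Φ : BoseGas.Config (n + 1) → ℂ, BoseGas.IsGroundState v L Φ → (∀ X, Φ X = (‖Φ X‖ : ℂ)) → (m : ENNReal) ^ 3 * ∫⁻ X : Fin n → EuclideanSpace ℝ (Fin 3), ((∑ k : Fin 3 → Fin m, (∫⁻ y in {y : EuclideanSpace ℝ (Fin 3) | ∀ i, y i ∈ Set.Ico ((k i : ℝ) * (L / m)) (((k i : ℝ) + 1) * (L / m))}, (‖Φ (Matrix.vecCons y X)‖₊ : ENNReal) ^ 2) ^ 2) / (∫⁻ y, (‖Φ (Matrix.vecCons y X)‖₊ : ENNReal) ^ 2)) ≤ ENNReal.ofReal A * (1 + ENNReal.ofReal (L ^ 3 / (n : ℝ) ^ 2 * ((∫ X in BoseGas.cellN n L, (∑ i : Fin n, ∑ j : Fin n, periodicHeatSum L (ℓ ^ 2 + 4 * η ^ 2) (X i - X j)) * Real.exp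 (-(b * H X))) / (∫ X in BoseGas.cellN n L, Real.exp (-(b * H X)))))) := by
  intro v hv
  obtain ⟨ρ₀, hρ₀, h⟩ := stub_groundStateBoundOfCrux hC v hv
  refine ⟨ρ₀, hρ₀, fun ρ hρ hρlt ℓ hℓ => ?_⟩
  obtain ⟨C, hCev⟩ := h ρ hρ hρlt ℓ hℓ
  refine ⟨max C 0, ?_⟩
  filter_upwards [hCev] with n hn
  intro L hL m hm a _ b _ η _ H _ Φ hgs hpos
  subst hL
  subst hm
  have key := hn Φ hgs hpos
  dsimp only at key
  calc _ ≤ ENNReal.ofReal C := key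
    _ ≤ ENNReal.ofReal (max C 0) := ENNReal.ofReal_le_ofReal (le_max_left _ _)
    _ ≤ ENNReal.ofReal (max C 0) * (1 + _) := le_mul_of_one_le_right zero_le le_self_add

/-- **The crux is equivalent to the registered stub S3′** (`stub_groundStateShadowVariance`):
`CoarseGrainedReverseHolder ↔` (for admissible `v`, small `ρ`, every `ℓ > 0`, some `A`, eventually in
`n`: every non-negative ground state has `F_{n,ℓ}(Φ) ≤ A(1 + W_n)` in the Bose dictionary). Forward:
`shadowVariance_of_coarseGrainedReverseHolder`; backward: the landed
`coarseGrainedReverseHolder_of_shadowVariance` (engine `W_n ≤ C` proved, then compactness + `L²`-Lipschitz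
transfer). Hence the last stub of line `registered` is exactly crux-sized. [folklore] -/
theorem coarseGrainedReverseHolder_iff_shadowVariance : CoarseGrainedReverseHolder ↔ ∀ v : ℝ → ENNReal, BoseGas.IsRepulsiveFiniteRange v → ∃ ρ₀ : ℝ, 0 < ρ₀ ∧ ∀ ρ : ℝ, 0 < ρ → ρ < ρ₀ → ∀ ℓ : ℝ, 0 < ℓ → ∃ A : ℝ, ∀ᶠ n : ℕ in Filter.atTop, ∀ (L : ℝ), L = BoseGas.sideLength ρ (n + 1) → ∀ (m : ℕ), m = ⌊L / ℓ⌋₊ → ∀ (a : ℝ), a = (BoseGas.scatteringLength v).toReal → ∀ (b : ℝ), b = 2 * Real.pi ^ (-(3 / 2 : ℝ)) * (a / ρ) ^ (1 / 2 : ℝ) → ∀ (η : ℝ), η = max ((8 * Real.pi * ρ * a) ^ (-(1 / 2 : ℝ))) (ρ ^ (-(1 / 3 : ℝ))) → ∀ (H : BoseGas.Config n → ℝ), H = (fun X => ∑ i : Fin n, ∑ j : Fin n with i < j, periodicRieszKernel 2 L η (X i - X j)) → ∀ Φ : BoseGas.Config (n + 1) → ℂ, BoseGas.IsGroundState v L Φ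 → (∀ X, Φ X = (‖Φ X‖ : ℂ)) → (m : ENNReal) ^ 3 * ∫⁻ X : Fin n → EuclideanSpace ℝ (Fin 3), ((∑ k : Fin 3 → Fin m, (∫⁻ y in {y : EuclideanSpace ℝ (Fin 3) | ∀ i, y i ∈ Set.Ico ((k i : ℝ) * (L / m)) (((k i : ℝ) + 1) * (L / m))}, (‖Φ (Matrix.vecCons y X)‖₊ : ENNReal) ^ 2) ^ 2) / (∫⁻ y, (‖Φ (Matrix.vecCons y X)‖₊ : ENNReal) ^ 2)) ≤ ENNReal.ofReal A * (1 + ENNReal.ofReal (L ^ 3 / (n : ℝ) ^ 2 * ((∫ X in BoseGas.cellN n L, (∑ i : Fin n, ∑ j : Fin n, periodicHeatSum L (ℓ ^ 2 + 4 * η ^ 2) (X i - X j)) * Real.exp (-(b * H X))) / (∫ X in BoseGas.cellN n L, Real.exp (-(b * H X)))))) :=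
  ⟨shadowVariance_of_coarseGrainedReverseHolder, coarseGrainedReverseHolder_of_shadowVariance⟩

/-- **S3′ is equivalent to the shadow-free ground-state bound**: the registered stub
`stub_groundStateShadowVariance` holds iff for admissible `v`, small `ρ`, every `ℓ > 0` there is `C`
with, eventually in `n`, `F_{n,ℓ}(Φ) ≤ C` for every non-negative ground state `Φ` of `n+1` bosons in the
Dirichlet box of side `((n+1)/ρ)^{1/3}`. Both sides are equivalent to the crux
(`coarseGrainedReverseHolder_iff_shadowVariance`, `coarseGrainedReverseHolder_iff_groundStates`): once
the classical engine is proved the shadow factor `(1 + W_n)` is decorative, and what is open is a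
statement about the true ground state alone. [folklore] -/
theorem shadowVariance_iff_groundStateBound : (∀ v : ℝ → ENNReal, BoseGas.IsRepulsiveFiniteRange v → ∃ ρ₀ : ℝ, 0 < ρ₀ ∧ ∀ ρ : ℝ, 0 < ρ → ρ < ρ₀ → ∀ ℓ : ℝ, 0 < ℓ → ∃ A : ℝ, ∀ᶠ n : ℕ in Filter.atTop, ∀ (L : ℝ), L = BoseGas.sideLength ρ (n + 1) → ∀ (m : ℕ), m = ⌊L / ℓ⌋₊ → ∀ (a : ℝ), a = (BoseGas.scatteringLength v).toReal → ∀ (b : ℝ), b = 2 * Real.pi ^ (-(3 / 2 : ℝ)) * (a / ρ) ^ (1 / 2 : ℝ) → ∀ (η : ℝ), η = max ((8 * Real.pi * ρ * a) ^ (-(1 / 2 : ℝ))) (ρ ^ (-(1 / 3 : ℝ))) → ∀ (H : BoseGas.Config n → ℝ), H = (fun X => ∑ i : Fin n, ∑ j : Fin n with i < j, periodicRieszKernel 2 L η (X i - X j)) → ∀ Φ : BoseGas.Config (n + 1) → ℂ, BoseGas.IsGroundState v L Φ → (∀ X, Φ X = (‖Φ X‖ : ℂ)) → (m : ENNReal)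 ^ 3 * ∫⁻ X : Fin n → EuclideanSpace ℝ (Fin 3), ((∑ k : Fin 3 → Fin m, (∫⁻ y in {y : EuclideanSpace ℝ (Fin 3) | ∀ i, y i ∈ Set.Ico ((k i : ℝ) * (L / m)) (((k i : ℝ) + 1) * (L / m))}, (‖Φ (Matrix.vecCons y X)‖₊ : ENNReal) ^ 2) ^ 2) / (∫⁻ y, (‖Φ (Matrix.vecCons y X)‖₊ : ENNReal) ^ 2)) ≤ ENNReal.ofReal A * (1 + ENNReal.ofReal (L ^ 3 / (n : ℝ) ^ 2 * ((∫ X in BoseGas.cellN n L, (∑ i : Fin n, ∑ j : Fin n, periodicHeatSum L (ℓ ^ 2 + 4 * η ^ 2) (X i - X j)) * Real.exp (-(b * H X))) / (∫ X in BoseGas.cellN n L, Real.exp (-(b * H X))))))) ↔ (∀ v : ℝ → ENNReal, BoseGas.IsRepulsiveFiniteRange v → ∃ ρ₀ : ℝ, 0 < ρ₀ ∧ ∀ ρ : ℝ, 0 < ρ → ρ < ρ₀ → ∀ ℓ : ℝ, 0 < ℓ → ∃ C : ℝ, ∀ᶠ n : ℕ in Filter.atTop, ∀ Φ : BoseGas.Config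 (n + 1) → ℂ, BoseGas.IsGroundState v (BoseGas.sideLength ρ (n + 1)) Φ → (∀ X, Φ X = (‖Φ X‖ : ℂ)) → let L := BoseGas.sideLength ρ (n + 1); let m := ⌊L / ℓ⌋₊; (m : ENNReal) ^ 3 * ∫⁻ X : Fin n → EuclideanSpace ℝ (Fin 3), ((∑ k : Fin 3 → Fin m, (∫⁻ y in {y : EuclideanSpace ℝ (Fin 3) | ∀ i, y i ∈ Set.Ico ((k i : ℝ) * (L / m)) (((k i : ℝ) + 1) * (L / m))}, (‖Φ (Matrix.vecCons y X)‖₊ : ENNReal) ^ 2) ^ 2) / (∫⁻ y, (‖Φ (Matrix.vecCons y X)‖₊ : ENNReal) ^ 2)) ≤ ENNReal.ofReal C) :=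
  coarseGrainedReverseHolder_iff_shadowVariance.symm.trans coarseGrainedReverseHolder_iff_groundStates

end Summit.AtomisticToContinuum.BoseEinsteinCondensation.Theorems.CoarseGrainedReverseHolder
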